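import Summits.Parity.GeneralizedHardyLittlewood.Theorems.LeeYangFibresCellParityLawDefs
import Summits.Parity.GeneralizedHardyLittlewood.Theorems.LeeYangFibresCellParityLawSingularRatio
import Summits.Parity.GeneralizedHardyLittlewood.Theorems.LeeYangFibresCellParityLawEulerRatio
import Literature.NumberTheory.Sieve.JurkatRichertRefutation
import HarnessLib

/-!
# Route `LeeYangFibres`, crux `CellParityLaw` (stmt-Parity-14109), line `section-annihilator`:
# Euler factors of Bombieri's constant (auxiliary file of the registered stub `stub_sectionMertens`)

For a non-degenerate system `Ψ = (ψ₀, …, ψ_t)` of one-dimensional forms `ψ_k(n) = a_k n + b_k` and a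
coordinate `i` (sub-system `Ψ₋ᵢ = Fin.removeNth i Ψ`, section density `g = sectionDensity Ψ i`), write
`E_p = (1 - g(p))/(1 - 1/p)` for the Euler factors of Bombieri's constant
`H = H_{Ψ,i} = lim_x ∏_{p ≤ x} E_p` (`sectionH`; `= 𝔖(Ψ)/𝔖(Ψ₋ᵢ) ≥ 0` when `𝔖(Ψ₋ᵢ) ≠ 0`,
`EulerRatioAux.sectionH_eq`) and `Π(z) = ∏_{p<z} (1 - 1/p)⁻¹` (`PairProducts.mertensProd`). This file
provides, for the Mertens-side main-term control `SectionMertens` (proved in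
`Theorems/LeeYangFibresCellParityLawMertens.lean`):

* `prod_one_sub_eq`: `V(z) = ∏_{p<z} (1 - g(p)) = (∏_{p<z} E_p) · Π(z)⁻¹`;
* `inv_mertensProd_le`: Mertens with rate, `Π(z)⁻¹ ≤ e^{-γ} e^{25/log z}/log z` (`z ≥ 2`);
* `eulerFactor_ge`: at a prime `p > L`, `p ≥ 2t + 2` (size `‖Ψ‖_N ≤ L`) all leading coefficients are
  units mod `p`, so with `G = goodCount Ψ p ≤ G' = goodCount Ψ₋ᵢ p`, `g(p) = (G' - G)/G'`
  (`EulerRatioAux.sectionDensity_prime`): `G' ≤ G + 1` (`goodCount_removeNth_le_add`) and `G' ≥ p - t`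
  (`le_goodCount_add`), whence `E_p ≥ (1 - 1/(p-t)) p/(p-1) ≥ 1 - 4t/p²`;
* `head_le`: the TAIL of Bombieri's constant — by Weierstrass' inequality (`APSystem.prod_ge_one_sub_sum`)
  and `∑_{n ≥ m} n⁻² ≤ 2/m`, `∏_{p ≤ x} E_p ≥ (∏_{p<m} E_p)(1 - 8t/m)` for `x ≥ m` once every prime
  `p ≥ m` has `p > L`, `p ≥ 2t + 2`, so in the limit `∏_{p<m} E_p ≤ H/(1 - 8t/m) ≤ H (1 + 16t/m)`;
* `head_le_crossDisc`: crudely, `∏_{p<m} E_p = ∏_{p<m} β_p(Ψ)/∏_{p<m} β_p(Ψ₋ᵢ) ≤ Δ/φ(Δ)` for the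
  cross-discriminant `Δ = |a_i| ∏_{k ≠ i} |a_i b_k - a_k b_i|` (`EulerRatioAux.prod_eulerFactor_mul`,
  `SingularRatio.singularProductPartial_le`).

References: E. Bombieri, *The asymptotic sieve*, Rend. Accad. Naz. XL (5) 1/2 (1975/76) 243–269
[BombieriAsymptoticSieve1976]; G. H. Hardy, E. M. Wright, Thm 429 (Mertens) [HardyWright2008];
B. Green, T. Tao, Ann. of Math. 171 (2010), Lemma 1.3 [GreenTao2010].
-/

noncomputable section

open scoped BigOperators Topology Classical
open Finset Filter Literature.NumberTheory.Sieve

namespace Summit.Parity.GeneralizedHardyLittlewood.Cruxes.CellParityLaw.SectionAnnihilator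

namespace MertensAux

variable {t : ℕ}

/-! ## One Euler factor -/

/-- The arithmetic of one tail factor: for `P ≥ 2T + 2`, `G ≥ P - T` and `D ≤ 1`,
`(1 - D/G)/(1 - 1/P) ≥ (1 - 1/(P-T)) P/(P-1) = 1 - T/((P-T)(P-1)) ≥ 1 - 4T/P²`. -/
theorem tail_factor_arith {P T G D : ℝ} (hT : 0 ≤ T) (hP : 2 * T + 2 ≤ P) (hG : P - T ≤ G)
    (hD1 : D ≤ 1) : 1 - 4 * T / P ^ 2 ≤ (1 - D / G) / (1 - P⁻¹) := by
  have hP0 : 0 < P := by linarith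
  have hPT : 0 < P - T := by linarith
  have hP0' : P ≠ 0 := hP0.ne'
  have hPT' : P - T ≠ 0 := hPT.ne'
  have h1P : 0 < 1 - P⁻¹ := by
    have : P⁻¹ ≤ 1 / 2 := by
      rw [inv_eq_one_div]; exact one_div_le_one_div_of_le two_pos (by linarith)
    linarith
  rw [le_div_iff₀ h1P]
  have hDG : D / G ≤ 1 / (P - T) :=
    (div_le_div_of_nonneg_right hD1 (by linarith)).trans (one_div_le_one_div_of_le hPT hG)
  have key : (1 - 4 * T / P ^ 2) * (1 - P⁻¹) + 1 / (P - T) ≤ 1 := by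
    rw [show (1 - 4 * T / P ^ 2) * (1 - P⁻¹) + 1 / (P - T) =
        ((P ^ 2 - 4 * T) * (P - 1) * (P - T) + P ^ 3) / (P ^ 3 * (P - T)) by field_simp,
      div_le_one (by positivity)]
    have h3 : 0 ≤ 3 * P - 4 * T - 4 := by linarith
    nlinarith [mul_nonneg (mul_nonneg hT hP0.le) h3, mul_nonneg hT hT]
  linarith

/-- `E_p = (1 - g(p))/(1 - 1/p) ≥ 0` when `g(p) < 1` (`1 - 1/p > 0` as `p > 1`). [folklore] -/
theorem eulerFactor_nonneg (Ψ : Fin (t + 1) → AffLinForm 1) (i : Fin (t + 1)) {p : ℕ}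
    (hp : p.Prime) (hg : sectionDensity Ψ i p < 1) :
    0 ≤ (1 - sectionDensity Ψ i p) / (1 - (p : ℝ)⁻¹) :=
  div_nonneg (sub_nonneg.mpr hg.le)
    (sub_pos.mpr (inv_lt_one_of_one_lt₀ (by exact_mod_cast hp.one_lt : (1 : ℝ) < p))).le

/-- **The tail factors**: for a prime `p > L` with `p ≥ 2t + 2`, all leading coefficients of the
non-degenerate system of size `≤ L` are units mod `p`, so `G' ≤ G + 1` (`card_zeros_eq_one_of_coeff`,
`goodCount_removeNth_le_add`), `G' ≥ p - t` (`le_goodCount_add`), and with `g(p) = (G' - G)/G'`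
(`EulerRatioAux.sectionDensity_prime`) `E_p ≥ 1 - 4t/p²`. -/
theorem eulerFactor_ge (Ψ : Fin (t + 1) → AffLinForm 1) (hΨ : IsNondegenerateSystem Ψ)
    {L N : ℕ} (hL : affLinSize Ψ N ≤ L) (i : Fin (t + 1)) {p : ℕ} (hp : p.Prime) (hLp : L < p)
    (htp : 2 * t + 2 ≤ p) :
    1 - 4 * (t : ℝ) / (p : ℝ) ^ 2 ≤ (1 - sectionDensity Ψ i p) / (1 - (p : ℝ)⁻¹) := by
  haveI := Fact.mk hp
  have hΨ' := SingularRatio.isNondegenerateSystem_removeNth hΨ i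
  have hunit : ∀ k, (((Ψ k).coeff 0 : ℤ) : ZMod p) ≠ 0 :=
    coeff_ne_zero_mod_of_affLinSize_le hΨ hL hLp
  have hunit' : ∀ k, (((Fin.removeNth i Ψ k).coeff 0 : ℤ) : ZMod p) ≠ 0 :=
    coeff_ne_zero_mod_of_affLinSize_le hΨ' ((affLinSize_removeNth_le Ψ i (N : ℝ)).trans hL) hLp
  have h1 : goodCount (Fin.removeNth i Ψ) p ≤ goodCount Ψ p + 1 := by
    have h := goodCount_removeNth_le_add Ψ i p
    rwa [card_zeros_eq_one_of_coeff (Ψ i) (hunit i)] at h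
  have h2 : p ≤ goodCount (Fin.removeNth i Ψ) p + t :=
    le_goodCount_add (Fin.removeNth i Ψ) p hunit'
  have e1 : (goodCount (Fin.removeNth i Ψ) p : ℝ) ≤ goodCount Ψ p + 1 := by exact_mod_cast h1
  have e2 : (p : ℝ) ≤ goodCount (Fin.removeNth i Ψ) p + t := by exact_mod_cast h2
  have htp' : 2 * (t : ℝ) + 2 ≤ p := by exact_mod_cast htp
  rw [EulerRatioAux.sectionDensity_prime Ψ i]
  exact tail_factor_arith (Nat.cast_nonneg t) htp' (by linarith) (by linarith)

/-! ## Mertens' product with rate; `V(z) = (∏ E_p) · Π(z)⁻¹` -/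

/-- **Mertens with rate, inverted**: `Π(z)⁻¹ ≤ e^{-γ} e^{25/log z}/log z` for `z ≥ 2`. -/
theorem inv_mertensProd_le {z : ℝ} (hz : 2 ≤ z) :
    (PairProducts.mertensProd z)⁻¹ ≤
      Real.exp (-Real.eulerMascheroniConstant) * Real.exp (25 / Real.log z) / Real.log z := by
  have hlogz : 0 < Real.log z := Real.log_pos (by linarith)
  obtain ⟨h1, -⟩ := abs_le.mp (PairProducts.abs_log_mertensProd_sub_le hz)
  have e : Real.exp (-Real.eulerMascheroniConstant) * Real.exp (25 / Real.log z) / Real.log z =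
      Real.exp (-Real.eulerMascheroniConstant + 25 / Real.log z - Real.log (Real.log z)) := by
    rw [Real.exp_sub, Real.exp_add, Real.exp_log hlogz]
  rw [e, ← Real.exp_log (PairProducts.mertensProd_pos z), ← Real.exp_neg, Real.exp_le_exp]
  linarith

/-- `V(z) = (∏_{p<z} E_p) · Π(z)⁻¹` (`E_p (1 - 1/p) = 1 - g(p)`). -/
theorem prod_one_sub_eq (Ψ : Fin (t + 1) → AffLinForm 1) (i : Fin (t + 1)) (z : ℝ) :
    ∏ p ∈ Nat.primesBelow ⌈z⌉₊, (1 - sectionDensity Ψ i p) =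
      (∏ p ∈ Nat.primesBelow ⌈z⌉₊, (1 - sectionDensity Ψ i p) / (1 - (p : ℝ)⁻¹)) *
        (PairProducts.mertensProd z)⁻¹ := by
  rw [PairProducts.mertensProd, ← Finset.prod_inv_distrib, ← Finset.prod_mul_distrib]
  refine Finset.prod_congr rfl fun p hp => ?_
  rw [inv_inv, div_mul_cancel₀ _ (sub_pos.mpr (inv_lt_one_of_one_lt₀
    (by exact_mod_cast (Nat.prime_of_mem_primesBelow hp).one_lt : (1 : ℝ) < p))).ne']

/-! ## The tail of Bombieri's constant -/

/-- The primes `p ≤ x` with `p < m` are the primes below `m`, once `m ≤ x + 1`. -/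
theorem filter_primesLE_lt {m x : ℕ} (hmx : m ≤ x + 1) :
    (Nat.primesLE x).filter (fun p => p < m) = Nat.primesBelow m := by
  ext p
  simp only [Finset.mem_filter, Nat.mem_primesLE, Nat.mem_primesBelow]
  exact ⟨fun ⟨⟨_, hp⟩, hlt⟩ => ⟨hlt, hp⟩, fun ⟨hlt, hp⟩ => ⟨⟨by omega, hp⟩, hlt⟩⟩

/-- `∑_{m ≤ p ≤ x} p⁻² ≤ ∑_{m-1 < n < x+1} n⁻² ≤ 2/m`. -/
theorem sum_inv_sq_tail_le {m : ℕ} (hm : 1 ≤ m) (x : ℕ) :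
    ∑ p ∈ (Nat.primesLE x).filter (fun p => ¬ p < m), ((p : ℝ) ^ 2)⁻¹ ≤ 2 / m := by
  have hsub : (Nat.primesLE x).filter (fun p => ¬ p < m) ⊆ Finset.Ioo (m - 1) (x + 1) := by
    intro p hp
    rw [Finset.mem_filter, Nat.mem_primesLE, not_lt] at hp
    rw [Finset.mem_Ioo]
    omega
  calc ∑ p ∈ (Nat.primesLE x).filter (fun p => ¬ p < m), ((p : ℝ) ^ 2)⁻¹
      ≤ ∑ n ∈ Finset.Ioo (m - 1) (x + 1), ((n : ℝ) ^ 2)⁻¹ :=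
        Finset.sum_le_sum_of_subset_of_nonneg hsub fun n _ _ => by positivity
    _ ≤ 2 / ((m - 1 : ℕ) + 1 : ℝ) := sum_Ioo_inv_sq_le (m - 1) (x + 1)
    _ = 2 / m := by rw [Nat.cast_sub hm, Nat.cast_one, sub_add_cancel]

/-- `∏_{p ≤ x} E_p → H_{Ψ,i}` when `𝔖(Ψ₋ᵢ) ≠ 0` (the partial products are eventually
`∏_{p ≤ x} β_p(Ψ)/∏_{p ≤ x} β_p(Ψ₋ᵢ)`, `EulerRatioAux.prod_eulerFactor_mul`; Green–Tao's Lemma 1.3 and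
`EulerRatioAux.sectionH_eq`). -/
theorem tendsto_eulerPartial (Ψ : Fin (t + 1) → AffLinForm 1) (hΨ : IsNondegenerateSystem Ψ)
    (i : Fin (t + 1)) (hne : singularProduct (Fin.removeNth i Ψ) ≠ 0) :
    Tendsto (fun x : ℕ => ∏ p ∈ Nat.primesLE x, (1 - sectionDensity Ψ i p) / (1 - (p : ℝ)⁻¹))
      atTop (𝓝 (sectionH Ψ i)) := by
  have hP := tendsto_singularProductPartial_holds 1 (t + 1) Ψ hΨ
  have hP' := tendsto_singularProductPartial_holds 1 t (Fin.removeNth i Ψ)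
    (SingularRatio.isNondegenerateSystem_removeNth hΨ i)
  rw [EulerRatioAux.sectionH_eq Ψ hΨ i hne]
  refine (hP.div hP' hne).congr' ?_
  filter_upwards [hP'.eventually_ne hne] with x hx
  rw [Pi.div_apply, div_eq_iff hx]
  exact (EulerRatioAux.prod_eulerFactor_mul Ψ i x).symm

/-- `H_{Ψ,i} = 𝔖(Ψ)/𝔖(Ψ₋ᵢ) ≥ 0`. -/
theorem sectionH_nonneg (Ψ : Fin (t + 1) → AffLinForm 1) (hΨ : IsNondegenerateSystem Ψ)
    (i : Fin (t + 1)) (hne : singularProduct (Fin.removeNth i Ψ) ≠ 0) : 0 ≤ sectionH Ψ i := by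
  rw [EulerRatioAux.sectionH_eq Ψ hΨ i hne]
  exact div_nonneg (SingularRatio.singularProduct_nonneg hΨ)
    (SingularRatio.singularProduct_nonneg (SingularRatio.isNondegenerateSystem_removeNth hΨ i))

/-- **The head of Bombieri's constant against the whole**: if every prime `p ≥ m` has `p > L`,
`p ≥ 2t + 2`, and `m ≥ 16t`, then `∏_{p ≤ x} E_p ≥ (∏_{p<m} E_p)(1 - 4t ∑_{m ≤ p ≤ x} p⁻²) ≥
(∏_{p<m} E_p)(1 - 8t/m)` for `x ≥ m`, so `∏_{p<m} E_p ≤ H/(1 - 8t/m) ≤ H (1 + 16t/m)`. -/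
theorem head_le (Ψ : Fin (t + 1) → AffLinForm 1) (hΨ : IsNondegenerateSystem Ψ) {L N : ℕ}
    (hL : affLinSize Ψ N ≤ L) (i : Fin (t + 1)) (hg1 : ∀ p : ℕ, p.Prime → sectionDensity Ψ i p < 1)
    (hne : singularProduct (Fin.removeNth i Ψ) ≠ 0) {m : ℕ} (hLm : L < m) (htm : 2 * t + 2 ≤ m)
    (h16 : 16 * t ≤ m) :
    ∏ p ∈ Nat.primesBelow m, (1 - sectionDensity Ψ i p) / (1 - (p : ℝ)⁻¹) ≤
      sectionH Ψ i * (1 + 16 * t / m) := by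
  have hm1 : 1 ≤ m := by omega
  have hm0 : (0 : ℝ) < m := by exact_mod_cast hm1
  have hE0 : ∀ p : ℕ, p.Prime → 0 ≤ (1 - sectionDensity Ψ i p) / (1 - (p : ℝ)⁻¹) := fun p hp =>
    eulerFactor_nonneg Ψ i hp (hg1 p hp)
  have hP0 : 0 ≤ ∏ p ∈ Nat.primesBelow m, (1 - sectionDensity Ψ i p) / (1 - (p : ℝ)⁻¹) :=
    Finset.prod_nonneg fun p hp => hE0 p (Nat.prime_of_mem_primesBelow hp)
  set S : ℝ := 8 * t / m with hS
  have hS0 : 0 ≤ S := by positivity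
  have hS2 : S ≤ 1 / 2 := by
    rw [hS, div_le_iff₀ hm0]
    have : (16 * t : ℝ) ≤ m := by exact_mod_cast h16
    linarith
  -- lower bound for the partial products beyond `m`
  have hlow : ∀ x : ℕ, m ≤ x →
      (∏ p ∈ Nat.primesBelow m, (1 - sectionDensity Ψ i p) / (1 - (p : ℝ)⁻¹)) * (1 - S) ≤
        ∏ p ∈ Nat.primesLE x, (1 - sectionDensity Ψ i p) / (1 - (p : ℝ)⁻¹) := by
    intro x hx
    have hW := Literature.Barriers.Parity.APSystem.prod_ge_one_sub_sum
      ((Nat.primesLE x).filter (fun p => ¬ p < m))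
      (fun p => (1 - sectionDensity Ψ i p) / (1 - (p : ℝ)⁻¹))
      (fun p => 4 * (t : ℝ) / (p : ℝ) ^ 2)
      (fun p hp => hE0 p (Nat.prime_of_mem_primesLE (Finset.mem_filter.mp hp).1))
      (fun p _ => by positivity) fun p hp => by
        obtain ⟨hp1, hp2⟩ := Finset.mem_filter.mp hp
        exact eulerFactor_ge Ψ hΨ hL i (Nat.prime_of_mem_primesLE hp1) (by omega) (by omega)
    have hsum : ∑ p ∈ (Nat.primesLE x).filter (fun p => ¬ p < m), 4 * (t : ℝ) / (p : ℝ) ^ 2 ≤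
        4 * (t : ℝ) * (2 / (m : ℝ)) := by
      rw [show ∑ p ∈ (Nat.primesLE x).filter (fun p => ¬ p < m), 4 * (t : ℝ) / (p : ℝ) ^ 2 =
          4 * (t : ℝ) * ∑ p ∈ (Nat.primesLE x).filter (fun p => ¬ p < m), ((p : ℝ) ^ 2)⁻¹ from by
        rw [Finset.mul_sum]; exact Finset.sum_congr rfl fun p _ => by rw [div_eq_mul_inv]]
      exact mul_le_mul_of_nonneg_left (sum_inv_sq_tail_le hm1 x) (by positivity)
    have hT : 1 - S ≤ ∏ p ∈ (Nat.primesLE x).filter (fun p => ¬ p < m),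
        (1 - sectionDensity Ψ i p) / (1 - (p : ℝ)⁻¹) := by
      refine le_trans ?_ hW
      have : 4 * (t : ℝ) * (2 / (m : ℝ)) = S := by rw [hS]; ring
      linarith
    calc (∏ p ∈ Nat.primesBelow m, (1 - sectionDensity Ψ i p) / (1 - (p : ℝ)⁻¹)) * (1 - S)
        ≤ (∏ p ∈ Nat.primesBelow m, (1 - sectionDensity Ψ i p) / (1 - (p : ℝ)⁻¹)) *
            ∏ p ∈ (Nat.primesLE x).filter (fun p => ¬ p < m),
              (1 - sectionDensity Ψ i p) / (1 - (p : ℝ)⁻¹) :=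
          mul_le_mul_of_nonneg_left hT hP0
      _ = ∏ p ∈ Nat.primesLE x, (1 - sectionDensity Ψ i p) / (1 - (p : ℝ)⁻¹) := by
          rw [← filter_primesLE_lt (by omega : m ≤ x + 1)]
          exact Finset.prod_filter_mul_prod_filter_not _ _ _
  have hlim := ge_of_tendsto (tendsto_eulerPartial Ψ hΨ i hne) (eventually_atTop.2 ⟨m, hlow⟩)
  have hH0 : 0 ≤ sectionH Ψ i := sectionH_nonneg Ψ hΨ i hne
  have h1S : 0 < 1 - S := by linarith
  have hkey : 1 ≤ (1 + 16 * (t : ℝ) / m) * (1 - S) := by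
    rw [show 16 * (t : ℝ) / m = 2 * S by rw [hS]; ring]
    nlinarith [mul_nonneg hS0 (by linarith : (0 : ℝ) ≤ 1 - 2 * S)]
  calc ∏ p ∈ Nat.primesBelow m, (1 - sectionDensity Ψ i p) / (1 - (p : ℝ)⁻¹)
      = (∏ p ∈ Nat.primesBelow m, (1 - sectionDensity Ψ i p) / (1 - (p : ℝ)⁻¹)) * (1 - S) /
          (1 - S) := by field_simp
    _ ≤ sectionH Ψ i / (1 - S) := div_le_div_of_nonneg_right hlim h1S.le
    _ ≤ sectionH Ψ i * (1 + 16 * t / m) := by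
        rw [div_le_iff₀ h1S, mul_assoc]
        nlinarith [mul_le_mul_of_nonneg_left hkey hH0]

/-- **The head, crudely**: `∏_{p<m} E_p = ∏_{p<m} β_p(Ψ)/∏_{p<m} β_p(Ψ₋ᵢ) ≤ Δ/φ(Δ)` for every multiple
`Δ ≠ 0` of `|a_i|` and all `|a_i b_k - a_k b_i|` (`𝔖(Ψ₋ᵢ) ≠ 0` makes every `β_p(Ψ₋ᵢ) > 0`;
`EulerRatioAux.prod_eulerFactor_mul`, `SingularRatio.singularProductPartial_le`). -/
theorem head_le_crossDisc (Ψ : Fin (t + 1) → AffLinForm 1) (hΨ : IsNondegenerateSystem Ψ)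
    (i : Fin (t + 1)) (hne : singularProduct (Fin.removeNth i Ψ) ≠ 0) {Δ : ℕ} (hΔ0 : Δ ≠ 0)
    (hΔa : ((Ψ i).coeff 0).natAbs ∣ Δ)
    (hΔD : ∀ k : Fin t, ((Ψ i).coeff 0 * (Ψ (i.succAbove k)).const -
      (Ψ (i.succAbove k)).coeff 0 * (Ψ i).const).natAbs ∣ Δ) (m : ℕ) :
    ∏ p ∈ Nat.primesBelow m, (1 - sectionDensity Ψ i p) / (1 - (p : ℝ)⁻¹) ≤
      (Δ : ℝ) / Nat.totient Δ := by
  have hΨ' := SingularRatio.isNondegenerateSystem_removeNth hΨ i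
  have hpos : 0 < singularProductPartial (Fin.removeNth i Ψ) (m - 1) :=
    Finset.prod_pos fun p hp => lt_of_le_of_ne (localFactor_nonneg _ p) fun h0 =>
      hne (singularProduct_eq_zero_of_localFactor_eq_zero _ hΨ' (Nat.prime_of_mem_primesLE hp)
        h0.symm)
  rw [Nat.primesBelow_eq_primesLE_sub_one,
    eq_div_of_mul_eq hpos.ne' (EulerRatioAux.prod_eulerFactor_mul Ψ i (m - 1)), div_le_iff₀ hpos]
  exact SingularRatio.singularProductPartial_le Ψ i hΔ0 hΔa hΔD (m - 1)

end MertensAux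

/-- **`stub_sectionMertensHead`** (registered sub-goal of the line, carried by this auxiliary file):
the tail of Bombieri's constant — for a non-degenerate system of size `≤ L`, a coordinate `i` with
`g(p) < 1` for all `p` and `𝔖(Ψ₋ᵢ) ≠ 0`, and `m > L`, `m ≥ 2t + 2`, `m ≥ 16t`:
`∏_{p<m} (1 - g(p))/(1 - 1/p) ≤ H_{Ψ,i} (1 + 16t/m)` (`MertensAux.head_le`). -/
theorem stub_sectionMertensHead : ∀ {t : ℕ} (Ψ : Fin (t + 1) → AffLinForm 1), IsNondegenerateSystem Ψ → ∀ {L N : ℕ}, affLinSize Ψ N ≤ L → ∀ i : Fin (t + 1), (∀ p : ℕ, p.Prime → sectionDensity Ψ i p < 1) → singularProduct (Fin.removeNth i Ψ) ≠ 0 → ∀ {m : ℕ}, L < m → 2 * t + 2 ≤ m → 16 * t ≤ m → ∏ p ∈ Nat.primesBelow m, (1 - sectionDensity Ψ i p) / (1 - (p : ℝ)⁻¹) ≤ sectionH Ψ i * (1 + 16 * t / m) :=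
  fun Ψ hΨ _ _ hL i hg1 hne _ hLm htm h16 => MertensAux.head_le Ψ hΨ hL i hg1 hne hLm htm h16

end Summit.Parity.GeneralizedHardyLittlewood.Cruxes.CellParityLaw.SectionAnnihilator

end
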